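import Literature.Analysis.FluidPDE.SwirlTransportProofs
import Literature.Analysis.FluidPDE.VorticityEquation
import Literature.Analysis.FluidPDE.IsometryInvariance
import HarnessLib

/-!
# Axisymmetric flows: transport of the swirl of the vorticity and Chen–Hou's `(θ̃, ω̃)` system

Analysis/FluidPDE support file on the decomposition path of `Literature.Analysis.FluidPDE.chen_hou_blowup`
(node "equivalence of the velocity–pressure formulation with Chen–Hou's variables"). For an
axisymmetric classical Navier–Stokes/Euler solution on `ℝ³ × S` write, with the infinitesimal
rotation `J v = (−v₁, v₀, 0)` of `SwirlTransportProofs` (`J x = r e_θ`),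

* `Γ = ⟪J x, u⟫ = r u_θ` (the swirl, `Fluid.swirl u`),
* `Ω = ⟪J x, ω⟫ = r ω_θ` (the swirl of the vorticity `ω = curl u`, `Fluid.swirl (curl u)`).

Pairing the vorticity equation `∂ₜω + (u·∇)ω = (ω·∇)u + νΔω` (`VorticityEquation`) with `J x`
gives the **transport equation of `Ω`**,
`∂ₜΩ + (u·∇)Ω = 2⟪J u, ω⟫ + ν ⟪J x, Δω⟫` (`IsClassicalNSSolutionOn.swirl_vorticity_transport`),
using `⟪Jx, (u·∇)ω⟫ = (u·∇)Ω − ⟪Ju, ω⟫` and `⟪Jx, (ω·∇)u⟫ = ⟪ω, Ju⟫` (infinitesimal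
axisymmetry `Du(Jx) = J u` and the algebraic identity `⟪Du ω, a⟫ = ⟪ω, Du a⟫` for `ω = curl u`).
For the unforced Euler equations this yields, off the axis, **Chen–Hou's system** (Part I, §6,
(6.5)–(6.6), p. 53) in the variables `θ̃ = (r u^θ)² = Γ²`, `ω̃ = ω^θ/r = Ω/r²`:

* `∂ₜθ̃ + (u·∇)θ̃ = 0` (`IsClassicalNSSolutionOn.chenHou_thetaTilde_transport`, from the
  swirl equation `swirl_transport_holds`),
* `∂ₜω̃ + (u·∇)ω̃ = r⁻⁴ ∂_z θ̃` (`IsClassicalNSSolutionOn.chenHou_omegaTilde_transport`),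

where `(u·∇) = u^r ∂ᵣ + u^z ∂_z` on axisymmetric scalars and `∂_z` is the derivative along
`e_z`. Also: `(ω·∇)Γ = 0` (`IsAxisymmetric.fderiv_swirl_curl`: the poloidal vorticity is
tangent to the level sets of `Γ`), and the vorticity of an axisymmetric field is axisymmetric
(`IsAxisymmetric.curl`, via `Du(R_θ x) = R_θ Du(x) R_{−θ}` and the algebraic equivariance
`curlvec (R_θ A R_{−θ}) = R_θ curlvec A`, `curlCLM_rotZL_conj`; the rotation as a continuous
linear map is `Fluid.rotZL`, as a linear isometry equivalence `Fluid.rotZLIE`), so that `Ω` is an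
axisymmetric scalar; and the pressure of a classical solution with axisymmetric velocity and
force is an axisymmetric scalar (`IsClassicalNSSolutionOn.isAxisymmetricScalar_pressure`, from
the rotation covariance of the equations, `IsometryInvariance`).

**Orientation remark.** Everything is in the right-handed frame of `AxisymmetricEuler`
(`e_θ = (−x₁, x₀, 0)/r`), in which (6.6) holds as printed; Chen–Hou print
`e_θ = (x₂, −x₁, 0)/r` (p. 53), the opposite orientation, under which `u^θ, ω^θ, ω̃` change sign
and `θ̃` does not, so the source term of (6.6) would change sign: the printed system (6.5)–(6.6)
(the standard one, Majda–Bertozzi §2.3.3, Luo–Hou 2014 (2.3)) is the right-handed one derived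
here. Only `|ω^θ|` enters `Literature.Analysis.FluidPDE.ChenHou2022_axisymmetricEulerBlowup`, so nothing upstream
depends on the orientation.

All statements are folklore calculus. [cite: arXiv221007191, §6 (6.5)–(6.6) p. 53]
-/

noncomputable section

open Set Function Filter Topology WithLp
open scoped Laplacian InnerProductSpace RealInnerProductSpace ContDiff

namespace Literature.Analysis.FluidPDE

/-- Local notation for physical space `ℝ³ = EuclideanSpace ℝ (Fin 3)`. -/
local notation "ℝ³" => EuclideanSpace ℝ (Fin 3)

/-! ### Algebra -/

/-- Expansion of a vector of `ℝ³` in the standard basis: `v = Σⱼ vⱼ eⱼ`. [folklore] -/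
theorem eq_sum_smul_single (v : ℝ³) : v = ∑ j, v j • EuclideanSpace.single j (1 : ℝ) := by
  ext i
  fin_cases i <;> simp [Fin.sum_univ_three]

/-- A linear map on `ℝ³` in coordinates, vector form: `A v = Σⱼ vⱼ A eⱼ` (the component form is
`VorticityStretching`'s `clm_apply_coord`). [folklore] -/
theorem clm_apply_eq_sum (A : ℝ³ →L[ℝ] ℝ³) (v : ℝ³) :
    A v = ∑ j, v j • A (EuclideanSpace.single j (1 : ℝ)) := by
  conv_lhs => rw [eq_sum_smul_single v]
  simp [map_sum, map_smul]

/-- For `ω = curlvec A` (the axial vector of `A − Aᵀ`), `⟪A ω, a⟫ = ⟪ω, A a⟫`: the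
antisymmetric part of `A` kills `ω` (`(A − Aᵀ) v = ω × v` vanishes on `v = ω`). For `A = Du(x)`:
`⟪(ω·∇)u, a⟫ = ⟪ω, Du a⟫`. Brute force in coordinates. [folklore] -/
theorem inner_apply_curlCLM (A : ℝ³ →L[ℝ] ℝ³) (a : ℝ³) : ⟪A (curlCLM A), a⟫ = ⟪curlCLM A, A a⟫ := by
  rw [clm_apply_eq_sum A (curlCLM A), clm_apply_eq_sum A a, curlCLM_apply]
  simp only [PiLp.inner_apply, RCLike.inner_apply, conj_trivial, Fin.sum_univ_three,
    PiLp.add_apply, PiLp.smul_apply, smul_eq_mul, Matrix.cons_val_zero, Matrix.cons_val_one,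
    Matrix.cons_val_two, Matrix.head_cons, Matrix.tail_cons]
  ring

/-- The generator is skew: `⟪J a, b⟫ = −⟪a, J b⟫`. [folklore] -/
theorem inner_rotGen_left_eq_neg (a b : ℝ³) : ⟪rotGen a, b⟫ = -⟪a, rotGen b⟫ := by
  rw [inner_rotGen_left, real_inner_comm, inner_rotGen_left]; ring

/-- **Lagrange's identity in the horizontal plane**: with `x_h = (x₀, x₁, 0)` and `J x`, an
orthogonal frame of the horizontal plane of lengths `r`,
`r² ⟪J u, w⟫ = ⟪x_h, u⟫⟪J x, w⟫ − ⟪J x, u⟫⟪x_h, w⟫`. [folklore] -/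
theorem cylRadius_sq_mul_inner_rotGen (x u w : ℝ³) :
    cylRadius x ^ 2 * ⟪rotGen u, w⟫ =
      ⟪(toLp 2 ![x 0, x 1, 0] : ℝ³), u⟫ * ⟪rotGen x, w⟫ -
        ⟪rotGen x, u⟫ * ⟪(toLp 2 ![x 0, x 1, 0] : ℝ³), w⟫ := by
  rw [cylRadius_sq, inner_rotGen_left, inner_rotGen_left, inner_rotGen_left]
  simp only [PiLp.inner_apply, RCLike.inner_apply, conj_trivial, Fin.sum_univ_three,
    Matrix.cons_val_zero, Matrix.cons_val_one, Matrix.cons_val_two, Matrix.head_cons,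
    Matrix.tail_cons]
  ring

/-- The horizontal component of the curl in terms of the generator:
`⟪curl u, x_h⟫ = (Du(Jx))₂ − ⟪Jx, Du e_z⟫` (expand `ω₀ = ∂₁u₂ − ∂₂u₁`, `ω₁ = ∂₂u₀ − ∂₀u₂`). [folklore] -/
theorem inner_curl_horizontal (u : ℝ³ → ℝ³) (x : ℝ³) :
    ⟪curl u x, (toLp 2 ![x 0, x 1, 0] : ℝ³)⟫ =
      fderiv ℝ u x (rotGen x) 2 - ⟪rotGen x, fderiv ℝ u x (EuclideanSpace.single 2 1)⟫ := by
  rw [inner_rotGen_left, rotGen_eq_sub_single, map_sub, map_smul, map_smul, curl_eq_curlCLM,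
    curlCLM_apply]
  simp only [PiLp.inner_apply, RCLike.inner_apply, conj_trivial, Fin.sum_univ_three,
    PiLp.sub_apply, PiLp.smul_apply, smul_eq_mul, Matrix.cons_val_zero, Matrix.cons_val_one,
    Matrix.cons_val_two, Matrix.head_cons, Matrix.tail_cons]
  ring

/-- For an axisymmetric field the horizontal (radial) vorticity is `ω_r = −∂_z u_θ`:
`⟪curl u, x_h⟫ = −⟪Jx, Du e_z⟫` (since `(Du(Jx))₂ = (J u)₂ = 0`). [folklore] -/
theorem IsAxisymmetric.inner_curl_horizontal {u : ℝ³ → ℝ³} (hu : IsAxisymmetric u) {x : ℝ³}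
    (hd : DifferentiableAt ℝ u x) :
    ⟪curl u x, (toLp 2 ![x 0, x 1, 0] : ℝ³)⟫ =
      -⟪rotGen x, fderiv ℝ u x (EuclideanSpace.single 2 1)⟫ := by
  rw [FluidPDE.inner_curl_horizontal, hu.fderiv_rotGen hd, rotGen_apply_two, zero_sub]

/-! ### Infinitesimal axisymmetry and the vorticity -/

/-- **`(ω·∇)Γ = 0` for axisymmetric fields**: the derivative of the swirl along the vorticity
vanishes, `DΓ(x)[curl u x] = 0` (`DΓ h = ⟪Jx, Du h⟫ + ⟪Jh, u⟫`, `⟪Jx, Du ω⟫ = ⟪ω, Du(Jx)⟫ = ⟪ω, Ju⟫`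
and `⟪Jω, u⟫ = −⟪ω, Ju⟫`). In cylindrical components: `ω_r ∂ᵣΓ + ω_z ∂_zΓ = 0` with
`ω_r = −(1/r)∂_zΓ`, `ω_z = (1/r)∂ᵣΓ`. [folklore] -/
theorem IsAxisymmetric.fderiv_swirl_curl {u : ℝ³ → ℝ³} (hu : IsAxisymmetric u) {x : ℝ³}
    (hd : DifferentiableAt ℝ u x) : fderiv ℝ (swirl u) x (curl u x) = 0 := by
  rw [fderiv_swirl_apply hd, ← real_inner_comm (rotGen x) (fderiv ℝ u x (curl u x)),
    curl_eq_curlCLM, inner_apply_curlCLM, hu.fderiv_rotGen hd, inner_rotGen_left_eq_neg,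
    add_neg_cancel]

/-- **`⟪Jx, (ω·∇)u⟫ = ⟪J u, ω⟫` for axisymmetric fields** (`(ω·∇)u = Du ω`,
`⟪Du ω, Jx⟫ = ⟪ω, Du(Jx)⟫ = ⟪ω, J u⟫`). In components: `r ((ω·∇)u)_θ-part = u_r ω_θ − u_θ ω_r`
up to the frame terms. [folklore] -/
theorem IsAxisymmetric.inner_rotGen_convect_curl {u : ℝ³ → ℝ³} (hu : IsAxisymmetric u) {x : ℝ³}
    (hd : DifferentiableAt ℝ u x) :
    ⟪rotGen x, convect (curl u) u x⟫ = ⟪rotGen (u x), curl u x⟫ := by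
  rw [convect_apply, ← real_inner_comm (rotGen x) (fderiv ℝ u x (curl u x)), curl_eq_curlCLM,
    inner_apply_curlCLM, hu.fderiv_rotGen hd]
  exact real_inner_comm _ _

/-! ### The vorticity of an axisymmetric field is axisymmetric -/

/-- The rotation `R_θ` about the axis as a continuous linear map. [folklore] -/
def rotZL (θ : ℝ) : ℝ³ →L[ℝ] ℝ³ :=
  LinearMap.toContinuousLinearMap
    { toFun := rotZ θ
      map_add' := fun v w => by ext i; fin_cases i <;> (simp; try ring)
      map_smul' := fun c v => by ext i; fin_cases i <;> (simp; try ring) }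

/-- `rotZL θ` is `rotZ θ`. [folklore] -/
@[simp] theorem rotZL_apply (θ : ℝ) (x : ℝ³) : rotZL θ x = rotZ θ x := rfl

/-- `R_θ ∘ R_{−θ} = id` as continuous linear maps. [folklore] -/
theorem rotZL_comp_neg (θ : ℝ) : (rotZL θ).comp (rotZL (-θ)) = ContinuousLinearMap.id ℝ ℝ³ := by
  ext1 x
  simp only [ContinuousLinearMap.comp_apply, rotZL_apply, ContinuousLinearMap.id_apply]
  rw [← rotZ_add, add_neg_cancel, rotZ_zero]

/-- **The curl is equivariant under rotations about the axis** (algebraic form): for every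
linear `A`, `curlvec (R_θ A R_{−θ}) = R_θ (curlvec A)` (the axial vector of a conjugated matrix;
`R_{−θ} = R_θᵀ`, and the cofactor matrix of `R_θ` is `R_θ` by `cos² + sin² = 1`). [folklore] -/
theorem curlCLM_rotZL_conj (θ : ℝ) (A : ℝ³ →L[ℝ] ℝ³) :
    curlCLM ((rotZL θ).comp (A.comp (rotZL (-θ)))) = rotZ θ (curlCLM A) := by
  have pyth := Real.sin_sq_add_cos_sq θ
  have h0 : rotZL (-θ) (EuclideanSpace.single 0 (1 : ℝ)) =
      Real.cos θ • EuclideanSpace.single 0 (1 : ℝ) - Real.sin θ • EuclideanSpace.single 1 (1 : ℝ) := by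
    ext i; fin_cases i <;> simp [Real.cos_neg, Real.sin_neg]
  have h1 : rotZL (-θ) (EuclideanSpace.single 1 (1 : ℝ)) =
      Real.sin θ • EuclideanSpace.single 0 (1 : ℝ) + Real.cos θ • EuclideanSpace.single 1 (1 : ℝ) := by
    ext i; fin_cases i <;> simp [Real.cos_neg, Real.sin_neg]
  have h2 : rotZL (-θ) (EuclideanSpace.single 2 (1 : ℝ)) = EuclideanSpace.single 2 (1 : ℝ) := by
    ext i; fin_cases i <;> simp
  rw [curlCLM_apply, curlCLM_apply]
  simp only [ContinuousLinearMap.comp_apply, h0, h1, h2, map_sub, map_add, map_smul, rotZL_apply]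
  ext i
  fin_cases i
  · simp; ring
  · simp; ring
  · simp
    linear_combination (A (EuclideanSpace.single 0 1) 1 - A (EuclideanSpace.single 1 1) 0) * pyth

/-- **Infinitesimal-free equivariance of the Jacobian**: for an axisymmetric field differentiable
everywhere, `Du(R_θ x) = R_θ ∘ Du(x) ∘ R_{−θ}` (differentiate `u ∘ R_θ = R_θ ∘ u`). [folklore] -/
theorem IsAxisymmetric.fderiv_rotZ {u : ℝ³ → ℝ³} (hu : IsAxisymmetric u) (hd : Differentiable ℝ u)
    (θ : ℝ) (x : ℝ³) :
    fderiv ℝ u (rotZ θ x) = (rotZL θ).comp ((fderiv ℝ u x).comp (rotZL (-θ))) := by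
  have hcomp : (fun y => u (rotZL θ y)) = fun y => rotZL θ (u y) := funext fun y => hu θ y
  have hl : HasFDerivAt (fun y => u (rotZL θ y)) ((fderiv ℝ u (rotZ θ x)).comp (rotZL θ)) x :=
    (hd (rotZL θ x)).hasFDerivAt.comp x (rotZL θ).hasFDerivAt
  have hr : HasFDerivAt (fun y => rotZL θ (u y)) ((rotZL θ).comp (fderiv ℝ u x)) x :=
    (rotZL θ).hasFDerivAt.comp x (hd x).hasFDerivAt
  rw [hcomp] at hl
  have heq := hl.unique hr
  calc fderiv ℝ u (rotZ θ x)
      = ((fderiv ℝ u (rotZ θ x)).comp (rotZL θ)).comp (rotZL (-θ)) := by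
          rw [ContinuousLinearMap.comp_assoc, rotZL_comp_neg, ContinuousLinearMap.comp_id]
    _ = ((rotZL θ).comp (fderiv ℝ u x)).comp (rotZL (-θ)) := by rw [heq]
    _ = (rotZL θ).comp ((fderiv ℝ u x).comp (rotZL (-θ))) := by
          rw [ContinuousLinearMap.comp_assoc]

/-- **The vorticity of an axisymmetric field is axisymmetric**: `curl u (R_θ x) = R_θ (curl u x)`
for an axisymmetric field differentiable everywhere (KNSS 2009, §1: `ω = ω_r e_r + ω_θ e_θ + ω_z e_z`
with components independent of the angle; Chen–Hou Part I §6 Notations). [folklore] -/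
theorem IsAxisymmetric.curl {u : ℝ³ → ℝ³} (hu : IsAxisymmetric u) (hd : Differentiable ℝ u) :
    IsAxisymmetric (FluidPDE.curl u) := fun θ x => by
  rw [curl_eq_curlCLM, curl_eq_curlCLM, hu.fderiv_rotZ hd θ x, curlCLM_rotZL_conj]

/-- Hence `Ω = ⟪Jx, ω⟫ = r ω_θ`, the swirl of the vorticity, is an axisymmetric scalar. [folklore] -/
theorem IsAxisymmetric.isAxisymmetricScalar_swirl_curl {u : ℝ³ → ℝ³} (hu : IsAxisymmetric u)
    (hd : Differentiable ℝ u) : IsAxisymmetricScalar (swirl (FluidPDE.curl u)) :=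
  (hu.curl hd).isAxisymmetricScalar_swirl

/-! ### The pressure of an axisymmetric flow is axisymmetric -/

/-- The rotation `R_θ` about the axis as a linear equivalence (inverse `R_{−θ}`). [folklore] -/
def rotZLinearEquiv (θ : ℝ) : ℝ³ ≃ₗ[ℝ] ℝ³ :=
  { (rotZL θ).toLinearMap with
    invFun := rotZ (-θ)
    left_inv := fun y => by
      show rotZ (-θ) (rotZ θ y) = y
      rw [← rotZ_add, neg_add_cancel, rotZ_zero]
    right_inv := fun y => by
      show rotZ θ (rotZ (-θ) y) = y
      rw [← rotZ_add, add_neg_cancel, rotZ_zero] }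

/-- The rotation `R_θ` about the axis as a linear isometry equivalence of `ℝ³` (`norm_rotZ`),
the form in which the rotation covariance of the equations is recorded in the tree
(`IsometryInvariance`). [folklore] -/
def rotZLIE (θ : ℝ) : ℝ³ ≃ₗᵢ[ℝ] ℝ³ :=
  ⟨rotZLinearEquiv θ, norm_rotZ θ⟩

/-- `rotZLIE θ` is `rotZ θ`. [folklore] -/
@[simp] theorem rotZLIE_apply (θ : ℝ) (x : ℝ³) : rotZLIE θ x = rotZ θ x := rfl

/-- The inverse of `rotZLIE θ` is `rotZ (−θ)`. [folklore] -/
@[simp] theorem rotZLIE_symm_apply (θ : ℝ) (x : ℝ³) : (rotZLIE θ).symm x = rotZ (-θ) x := rfl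

/-- Conjugating an axisymmetric field by `R_θ` gives it back: `R_θ (u (R_{−θ} x)) = u x`. [folklore] -/
theorem IsAxisymmetric.rotZ_apply_rotZ_neg {u : ℝ³ → ℝ³} (hu : IsAxisymmetric u) (θ : ℝ) (x : ℝ³) :
    rotZ θ (u (rotZ (-θ) x)) = u x := by
  rw [← hu θ, ← rotZ_add, add_neg_cancel, rotZ_zero]

/-- **The pressure of an axisymmetric classical flow is axisymmetric.** For a classical
Navier–Stokes/Euler solution on `ℝ³ × S` (`S` of unique differentiability) with axisymmetric
velocity and force at all times of `S`, the pressure is an axisymmetric scalar at every `t ∈ S`: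
the rotated pair `(R u R⁻¹, p ∘ R⁻¹) = (u, p ∘ R⁻¹)` solves the same equations
(`IsClassicalNSSolutionOn.conj_linearIsometryEquiv`), so `∇(p ∘ R⁻¹) = ∇p`, hence `p ∘ R⁻¹ − p`
is constant (`is_const_of_fderiv_eq_zero`), and it vanishes at the origin, a fixed point of `R`
(KNSS 2009, §1: in the axisymmetric class "`p = p(r, z, t)`"). [folklore] -/
theorem IsClassicalNSSolutionOn.isAxisymmetricScalar_pressure {S : Set ℝ} {ν : ℝ}
    {f u : ℝ → ℝ³ → ℝ³} {p : ℝ → ℝ³ → ℝ} (h : IsClassicalNSSolutionOn S ν f u p)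
    (hS : UniqueDiffOn ℝ S) (hu : ∀ t ∈ S, IsAxisymmetric (u t))
    (hf : ∀ t ∈ S, IsAxisymmetric (f t)) {t : ℝ} (ht : t ∈ S) : IsAxisymmetricScalar (p t) := by
  have key : ∀ θ : ℝ, ∀ x : ℝ³, p t (rotZ (-θ) x) = p t x := by
    intro θ
    set R := rotZLIE θ with hR
    have hv := h.conj_linearIsometryEquiv R hS
    have hslice : (fun y => R (u t (R.symm y))) = u t :=
      funext fun y => (hu t ht).rotZ_apply_rotZ_neg θ y
    have hdiffp : Differentiable ℝ (p t) := (h.contDiff_pressure ht).differentiable (by simp)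
    have hdiffp' : Differentiable ℝ (fun y => p t (R.symm y)) :=
      hdiffp.comp R.symm.toContinuousLinearEquiv.differentiable
    -- the two pressures have the same gradient
    have hgrad : ∀ x, gradient (fun y => p t (R.symm y)) x = gradient (p t) x := by
      intro x
      have m1 := hv.momentum t ht x
      have m2 := h.momentum t ht x
      have htd : timeDerivWithin S (fun s y => R (u s (R.symm y))) t x = timeDerivWithin S u t x := by
        rw [timeDerivWithin_apply, timeDerivWithin_apply]
        exact derivWithin_congr (fun s hs => (hu s hs).rotZ_apply_rotZ_neg θ x)
          ((hu t ht).rotZ_apply_rotZ_neg θ x)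
      have hforce : R (f t (R.symm x)) = f t x := (hf t ht).rotZ_apply_rotZ_neg θ x
      beta_reduce at m1
      rw [htd, hslice, hforce, m2] at m1
      -- `m1 : ν • Δu − ∇p + f = ν • Δu − ∇(p ∘ R⁻¹) + f`
      have := m1
      rw [add_left_inj, sub_right_inj] at this
      exact this.symm
    -- hence `p t − p t ∘ R⁻¹` has zero derivative and is constant
    have hqd : Differentiable ℝ (fun y => p t y - p t (R.symm y)) := hdiffp.sub hdiffp'
    have hq : ∀ x, fderiv ℝ (fun y => p t y - p t (R.symm y)) x = 0 := fun x => by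
      rw [fderiv_fun_sub (hdiffp x) (hdiffp' x)]
      have e := (InnerProductSpace.toDual ℝ ℝ³).symm.injective (hgrad x)
      rw [e, sub_self]
    intro x
    have hc := is_const_of_fderiv_eq_zero hqd hq x 0
    simp only [map_zero, sub_self] at hc
    exact (sub_eq_zero.1 hc).symm
  intro θ x
  simpa using key (-θ) x

/-! ### The transport equation of `Ω = ⟪J x, ω⟫ = r ω_θ` -/

section Transport

variable {S : Set ℝ} {ν : ℝ} {f u : ℝ → ℝ³ → ℝ³} {p : ℝ → ℝ³ → ℝ}

/-- The vorticity of a jointly smooth velocity is jointly smooth (on a time set of unique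
differentiability). [folklore] -/
theorem IsSmoothSpaceTimeOn.isSmoothSpaceTimeOn_vorticity (h : IsSmoothSpaceTimeOn S u)
    (hS : UniqueDiffOn ℝ S) : IsSmoothSpaceTimeOn S (FluidPDE.vorticity u) := by
  have : FluidPDE.vorticity u = fun t x => curlCLM (fderiv ℝ (u t) x) := by
    funext t x; rfl
  rw [this]
  exact (h.fderiv_slice hS).clm_comp curlCLM

/-- **Transport of the swirl of the vorticity** of an axisymmetric classical Navier–Stokes
solution with curl-free force, on a time set `S ⊆ closure (interior S)` of unique
differentiability, at every `t ∈ S` and every `x`: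
`∂ₜΩ + (u·∇)Ω = 2⟪J u, ω⟫ + ν ⟪J x, Δω⟫`, `Ω = ⟪Jx, ω⟫ = r ω_θ`, `ω = curl u`
(pair the vorticity equation with `J x`; Majda–Bertozzi §2.3.3, (2.58) in the form
`D̃/Dt (ω^θ/r)`; Chen–Hou Part I (6.1)). [folklore] -/
theorem IsClassicalNSSolutionOn.swirl_vorticity_transport (h : IsClassicalNSSolutionOn S ν f u p)
    (hS : UniqueDiffOn ℝ S) (hcl : S ⊆ closure (interior S))
    (hcurl : ∀ t ∈ S, ∀ x, curl (f t) x = 0) (hu : ∀ t ∈ S, IsAxisymmetric (u t)) {t : ℝ}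
    (ht : t ∈ S) (x : ℝ³) :
    timeDerivWithin S (fun s => swirl (vorticity u s)) t x +
        convect (u t) (swirl (vorticity u t)) x =
      2 * ⟪rotGen (u t x), vorticity u t x⟫ + ν * ⟪rotGen x, (Δ (vorticity u t)) x⟫ := by
  have hU1 : DifferentiableAt ℝ (u t) x :=
    ((h.contDiff_velocity ht).differentiable (by simp)) x
  have hω : IsSmoothSpaceTimeOn S (vorticity u) := h.smooth_velocity.isSmoothSpaceTimeOn_vorticity hS
  have hωd : DifferentiableAt ℝ (vorticity u t) x :=
    ((hω.contDiff_slice ht).differentiable (by simp)) x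
  have hveq := congrArg (fun v : ℝ³ => ⟪rotGen x, v⟫) (h.vorticity_eq hS hcl hcurl ht x)
  simp only [inner_add_right, inner_smul_right] at hveq
  have h1 : timeDerivWithin S (fun s => swirl (vorticity u s)) t x =
      ⟪rotGen x, timeDerivWithin S (vorticity u) t x⟫ := timeDerivWithin_swirl hω ht x
  have h2 : convect (u t) (swirl (vorticity u t)) x =
      ⟪rotGen x, convect (u t) (vorticity u t) x⟫ + ⟪rotGen (u t x), vorticity u t x⟫ := by
    rw [convect_apply, fderiv_swirl_apply hωd, convect_apply]
  have h3 : ⟪rotGen x, convect (vorticity u t) (u t) x⟫ = ⟪rotGen (u t x), vorticity u t x⟫ := by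
    rw [vorticity_apply]; exact (hu t ht).inner_rotGen_convect_curl hU1
  rw [h1, h2, ← add_assoc, hveq, h3]
  ring

/-! ### The unforced axisymmetric Euler equations: Chen–Hou's `(θ̃, ω̃)` system off the axis -/

/-- **Chen–Hou's `θ̃`-equation** (Part I, (6.5)–(6.6), p. 53: `θ̃ = (r u^θ)²`,
`∂ₜθ̃ + u^r θ̃_r + u^z θ̃_z = 0`): for an unforced classical Euler solution with axisymmetric
velocity on a time set of unique differentiability, off the axis, `∂ₜ(Γ²) + (u·∇)(Γ²) = 0`,
`Γ = r u_θ = swirl u` (from the swirl equation `swirl_transport_holds` with `ν = 0`, `f = 0`; the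
pressure is axisymmetric by `isAxisymmetricScalar_pressure`). [cite: arXiv221007191, §6 (6.5)–(6.6) p. 53] -/
theorem IsClassicalNSSolutionOn.chenHou_thetaTilde_transport {u : ℝ → ℝ³ → ℝ³} {p : ℝ → ℝ³ → ℝ}
    (h : IsClassicalEulerSolutionOn S 0 u p) (hS : UniqueDiffOn ℝ S)
    (hu : ∀ t ∈ S, IsAxisymmetric (u t)) {t : ℝ} (ht : t ∈ S) {x : ℝ³}
    (hx : cylRadius x ≠ 0) :
    timeDerivWithin S (fun s y => swirl (u s) y ^ 2) t x +
      convect (u t) (fun y => swirl (u t) y ^ 2) x = 0 := by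
  have hp : ∀ s ∈ S, IsAxisymmetricScalar (p s) := fun s hs =>
    h.isAxisymmetricScalar_pressure hS hu (fun _ _ θ y => by ext i; fin_cases i <;> simp) hs
  have hΓ := swirl_transport_holds h hu hp ht hx
  have hswirl0 : swirl ((0 : ℝ → ℝ³ → ℝ³) t) x = 0 := by simp [swirl]
  rw [zero_mul, zero_add, hswirl0] at hΓ
  have hU1 : DifferentiableAt ℝ (u t) x :=
    ((h.contDiff_velocity ht).differentiable (by simp)) x
  -- time derivative of the square
  have hdt : HasDerivWithinAt (fun s => swirl (u s) x) (timeDerivWithin S (fun s => swirl (u s)) t x)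
      S t := by
    have hd : DifferentiableWithinAt ℝ (fun s => swirl (u s) x) S t := by
      simp only [swirl_eq_inner_rotGen]
      exact (differentiableWithinAt_const _).inner ℝ (h.smooth_velocity.differentiableWithinAt_time ht x)
    exact hd.hasDerivWithinAt
  have ht2 : timeDerivWithin S (fun s y => swirl (u s) y ^ 2) t x =
      2 * swirl (u t) x * timeDerivWithin S (fun s => swirl (u s)) t x := by
    rw [timeDerivWithin_apply]
    by_cases hU : UniqueDiffWithinAt ℝ S t
    · rw [(hdt.fun_pow 2).derivWithin hU]
      push_cast
      ring
    · rw [derivWithin_zero_of_not_uniqueDiffWithinAt hU, timeDerivWithin_apply,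
        derivWithin_zero_of_not_uniqueDiffWithinAt hU, mul_zero]
  -- convective derivative of the square
  have hc2 : convect (u t) (fun y => swirl (u t) y ^ 2) x =
      2 * swirl (u t) x * convect (u t) (swirl (u t)) x := by
    rw [convect_apply, convect_apply,
      show (fun y => swirl (u t) y ^ 2) = fun y => swirl (u t) y * swirl (u t) y from
        funext fun y => sq _,
      fderiv_fun_mul (differentiableAt_swirl hU1) (differentiableAt_swirl hU1)]
    simp only [_root_.add_apply, _root_.smul_apply, smul_eq_mul]
    ring
  rw [ht2, hc2, ← mul_add, hΓ, mul_zero]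

/-- The derivative of `y ↦ r(y)² = y₀² + y₁²` is `h ↦ 2x₀h₀ + 2x₁h₁ = 2⟪x_h, h⟫`. [folklore] -/
theorem hasFDerivAt_cylRadius_sq (x : ℝ³) :
    HasFDerivAt (fun y : ℝ³ => cylRadius y ^ 2)
      ((2 * x 0) • (EuclideanSpace.proj (0 : Fin 3) : ℝ³ →L[ℝ] ℝ) +
        (2 * x 1) • (EuclideanSpace.proj (1 : Fin 3) : ℝ³ →L[ℝ] ℝ)) x := by
  have h0 : HasFDerivAt (fun y : ℝ³ => y 0) (EuclideanSpace.proj (0 : Fin 3) : ℝ³ →L[ℝ] ℝ) x :=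
    (EuclideanSpace.proj (0 : Fin 3) : ℝ³ →L[ℝ] ℝ).hasFDerivAt
  have h1 : HasFDerivAt (fun y : ℝ³ => y 1) (EuclideanSpace.proj (1 : Fin 3) : ℝ³ →L[ℝ] ℝ) x :=
    (EuclideanSpace.proj (1 : Fin 3) : ℝ³ →L[ℝ] ℝ).hasFDerivAt
  have e : (fun y : ℝ³ => cylRadius y ^ 2) = fun y : ℝ³ => y 0 * y 0 + y 1 * y 1 :=
    funext fun y => by rw [cylRadius_sq]; ring
  rw [e]
  have h2 := (h0.mul h0).add (h1.mul h1)
  refine HasFDerivAt.congr_fderiv h2 ?_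
  ext h
  simp only [_root_.add_apply, _root_.smul_apply, smul_eq_mul,
    PiLp.proj_apply]
  ring

/-- Differentiability of `y ↦ (r(y)²)⁻¹` off the axis, with derivative `h ↦ −2⟪x_h, h⟫ / r⁴`
(Mathlib `HasFDerivAt.inv`). [folklore] -/
theorem hasFDerivAt_inv_cylRadius_sq {x : ℝ³} (hx : cylRadius x ≠ 0) :
    HasFDerivAt (fun y : ℝ³ => (cylRadius y ^ 2)⁻¹)
      (-((cylRadius x ^ 2) ^ 2)⁻¹ • ((2 * x 0) • (EuclideanSpace.proj (0 : Fin 3) : ℝ³ →L[ℝ] ℝ) +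
        (2 * x 1) • (EuclideanSpace.proj (1 : Fin 3) : ℝ³ →L[ℝ] ℝ))) x := by
  have h := (hasFDerivAt_inv (pow_ne_zero 2 hx)).comp x (hasFDerivAt_cylRadius_sq x)
  refine h.congr_fderiv ?_
  ext v
  simp only [ContinuousLinearMap.comp_apply, ContinuousLinearMap.toSpanSingleton_apply,
    _root_.smul_apply, smul_eq_mul]
  ring

/-- **Chen–Hou's `ω̃`-equation** (Part I, (6.5)–(6.6), p. 53: `ω̃ = ω^θ/r`,
`∂ₜω̃ + u^r ω̃_r + u^z ω̃_z = r⁻⁴ ∂_z θ̃`): for an unforced classical Euler solution with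
axisymmetric velocity on a time set `S ⊆ closure (interior S)` of unique differentiability, at
`t ∈ S` and off the axis, with `ω̃ = Ω/r² = ⟪Jx, ω⟫/r²` (`= ω_θ/r`) and `θ̃ = Γ²`,
`∂ₜω̃ + (u·∇)ω̃ = r⁻⁴ ∂_{e_z}(Γ²)`. Proof: `∂ₜΩ + (u·∇)Ω = 2⟪Ju, ω⟫`
(`swirl_vorticity_transport`, `ν = 0`), `(u·∇)r⁻² = −2 r⁻⁴ ⟪x_h, u⟫`, Lagrange's identity
`r²⟪Ju, ω⟫ = ⟪x_h, u⟫Ω − Γ ⟪x_h, ω⟫`, and `⟪x_h, ω⟫ = −⟪Jx, Du e_z⟫ = −∂_zΓ` for axisymmetric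
`u` (`ω_r = −∂_z u_θ`), while `∂_z(Γ²) = 2Γ⟪Jx, Du e_z⟫` (`J e_z = 0`). Orientation: right-handed
`e_θ` (module docstring). [cite: arXiv221007191, §6 (6.5)–(6.6) p. 53] -/
theorem IsClassicalNSSolutionOn.chenHou_omegaTilde_transport {u : ℝ → ℝ³ → ℝ³}
    {p : ℝ → ℝ³ → ℝ} (h : IsClassicalEulerSolutionOn S 0 u p) (hS : UniqueDiffOn ℝ S)
    (hcl : S ⊆ closure (interior S)) (hu : ∀ t ∈ S, IsAxisymmetric (u t)) {t : ℝ} (ht : t ∈ S)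
    {x : ℝ³} (hx : cylRadius x ≠ 0) :
    timeDerivWithin S (fun s y => swirl (vorticity u s) y * (cylRadius y ^ 2)⁻¹) t x +
        convect (u t) (fun y => swirl (vorticity u t) y * (cylRadius y ^ 2)⁻¹) x =
      (cylRadius x ^ 4)⁻¹ * partialDeriv eZ (fun y => swirl (u t) y ^ 2) x := by
  have hU1 : DifferentiableAt ℝ (u t) x :=
    ((h.contDiff_velocity ht).differentiable (by simp)) x
  have hω : IsSmoothSpaceTimeOn S (vorticity u) := h.smooth_velocity.isSmoothSpaceTimeOn_vorticity hS
  have hωd : DifferentiableAt ℝ (vorticity u t) x :=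
    ((hω.contDiff_slice ht).differentiable (by simp)) x
  -- the `Ω`-equation with `ν = 0`
  have hΩ := h.swirl_vorticity_transport hS hcl (fun _ _ y => curl_zero y) hu ht x
  rw [zero_mul, add_zero] at hΩ
  -- time derivative: the factor `r⁻²` does not depend on time
  have ht2 : timeDerivWithin S (fun s y => swirl (vorticity u s) y * (cylRadius y ^ 2)⁻¹) t x =
      timeDerivWithin S (fun s => swirl (vorticity u s)) t x * (cylRadius x ^ 2)⁻¹ := by
    rw [timeDerivWithin_apply, timeDerivWithin_apply, derivWithin_mul_const]
    simp only [swirl_eq_inner_rotGen]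
    exact (differentiableWithinAt_const _).inner ℝ (hω.differentiableWithinAt_time ht x)
  -- convective derivative: product rule
  have hΩd : DifferentiableAt ℝ (swirl (vorticity u t)) x := differentiableAt_swirl hωd
  have hr := hasFDerivAt_inv_cylRadius_sq hx
  have hc2 : convect (u t) (fun y => swirl (vorticity u t) y * (cylRadius y ^ 2)⁻¹) x =
      convect (u t) (swirl (vorticity u t)) x * (cylRadius x ^ 2)⁻¹ +
        swirl (vorticity u t) x * (-((cylRadius x ^ 2) ^ 2)⁻¹ *
          (2 * x 0 * u t x 0 + 2 * x 1 * u t x 1)) := by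
    rw [convect_apply, convect_apply, fderiv_fun_mul hΩd hr.differentiableAt, hr.fderiv]
    simp only [_root_.add_apply, _root_.smul_apply, smul_eq_mul, PiLp.proj_apply]
    ring
  -- the source term `r⁻⁴ ∂_z (Γ²) = 2 r⁻⁴ Γ ⟪Jx, Du e_z⟫`
  have hsrc : partialDeriv eZ (fun y => swirl (u t) y ^ 2) x =
      2 * swirl (u t) x * ⟪rotGen x, fderiv ℝ (u t) x (EuclideanSpace.single 2 1)⟫ := by
    rw [partialDeriv_apply,
      show (fun y => swirl (u t) y ^ 2) = fun y => swirl (u t) y * swirl (u t) y from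
        funext fun y => sq _,
      fderiv_fun_mul (differentiableAt_swirl hU1) (differentiableAt_swirl hU1)]
    simp only [_root_.add_apply, _root_.smul_apply, smul_eq_mul]
    rw [fderiv_swirl_apply hU1, eZ, rotGen_single_two, inner_zero_left, add_zero]
    ring
  -- the algebra: Lagrange's identity and `⟪x_h, ω⟫ = −⟪Jx, Du e_z⟫`
  have hhor : ⟪(toLp 2 ![x 0, x 1, 0] : ℝ³), vorticity u t x⟫ =
      -⟪rotGen x, fderiv ℝ (u t) x (EuclideanSpace.single 2 1)⟫ := by
    rw [real_inner_comm, vorticity_apply]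
    exact (hu t ht).inner_curl_horizontal hU1
  have hxu : ⟪(toLp 2 ![x 0, x 1, 0] : ℝ³), u t x⟫ = x 0 * u t x 0 + x 1 * u t x 1 := by
    simp only [PiLp.inner_apply, RCLike.inner_apply, conj_trivial, Fin.sum_univ_three,
      Matrix.cons_val_zero, Matrix.cons_val_one, Matrix.cons_val_two, Matrix.head_cons,
      Matrix.tail_cons]
    ring
  have hΓ : swirl (u t) x = ⟪rotGen x, u t x⟫ := by rw [swirl_eq_inner_rotGen]
  have hΩ' : swirl (vorticity u t) x = ⟪rotGen x, vorticity u t x⟫ := by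
    rw [swirl_eq_inner_rotGen]
  have hlag := cylRadius_sq_mul_inner_rotGen x (u t x) (vorticity u t x)
  rw [hxu, hhor, ← hΩ', ← hΓ] at hlag
  have hq : (cylRadius x ^ 2)⁻¹ * cylRadius x ^ 2 = 1 := inv_mul_cancel₀ (pow_ne_zero 2 hx)
  have hr4 : (cylRadius x ^ 4)⁻¹ = (cylRadius x ^ 2)⁻¹ ^ 2 := by
    rw [← inv_pow]; ring
  rw [ht2, hc2, hsrc, eq_sub_of_add_eq hΩ, hr4]
  linear_combination 2 * (cylRadius x ^ 2)⁻¹ ^ 2 * hlag -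
    2 * ⟪rotGen (u t x), vorticity u t x⟫ * (cylRadius x ^ 2)⁻¹ * hq

end Transport

end Literature.Analysis.FluidPDE
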